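import Literature.MathematicalPhysics.QuantumFieldTheory.Balaban1983to89.Beta.AffineAveraging

/-!
# `BalabanUV.Beta.GAN24.FibreSymbols` — binder row G-an2-4 / (CONV-C), road P1-fibre, node N03 of `SKELETON-P1.md`: the PLANE-WAVE SYMBOLS of the
# local lattice operators of the typed `U = 1` KKT system (`AffineAveraging.dz`, `codiff₁`, `curv`, `curvAdj`), i.e. the diagonal-in-fine-momentum
# part of the Bloch fibre matrix of `BlochFibreMatrix.resid`

NOT IN PRINT; OUR PROOF ATTEMPT.  HONEST FRAMING (cell contract, verbatim): «discharging `BetaPertH` makes Bałaban's UV stability UNCONDITIONAL — a real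
constructive-QFT result; it is NOT the continuum limit and NOT the Clay problem.»  HONEST DEPENDENCY (verbatim): «continuum YM on T⁴ ⇐ BetaPertH ∧ nine spine
estimates (0/9 proved); BetaPertH ⇐ (D1) ∧ (D4) ∧ CAP+tail; G-an2-4 gates asym, D1 and NE2/3/4.»  [folklore] finite-difference algebra on plane waves over `ℂ`
(no estimate, no cited fact, no wall binder).  NOT summit progress.

## What is proved (generic dimension `D`; complex momentum `k : Fin D → ℂ`, so the formulas serve the analytic continuation as well)
With the plane wave `pw k x = exp(i Σ_μ k_μ x_μ)`, the forward symbol `dhat k κ = e^{ik_κ} − 1` and its REFLECTION `dflat k κ = e^{−ik_κ} − 1` (equal to the complex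
conjugate for real `k`; kept as an independent holomorphic expression):
* `dz_plane`:            `dz (c·pw) = (κ ↦ dhat_κ · c) · pw`                                  (gradient ↦ `∂̂`);
* `codiff₁_plane`:       `codiff₁ (v·pw) = (Σ_κ dflat_κ v_κ) · pw`                            (codifferential ↦ `∂̂♭ᵀ`);
* `curv_plane`:          `curv (v·pw) κ l = (dhat_κ v_l − dhat_l v_κ) · pw`;
* `curvAdj_curv_plane`:  `curvAdj (curv (v·pw)) = (μ ↦ 2·(L v_μ − dhat_μ Σ_κ dflat_κ v_κ)) · pw`,  `L := Σ_κ dhat_κ dflat_κ`  — the symbol `2(|∂̂|²·1 − ∂̂∂̂♭ᵀ)` of S1a;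
* `gauge_plane`:         `dz (codiff₁ (dz (c·pw))) = (κ ↦ dhat_κ · L · c) · pw`                 — the `μ`-column symbol `∂̂|∂̂|²`;
* `Gamma_plane`:         `codiff₁ (dz (codiff₁ (v·pw))) = (L · Σ_κ dflat_κ v_κ) · pw`           — the G-row symbol `|∂̂|²∂̂♭ᵀ`.
§2 (v1.1, APPEND-ONLY; v1 declarations byte-identical): `gsum z N = Σ_{t<N} e^{izt}`, `pw_add`, `pw_natSmul_unitVec`, `pw_toSite`, and the BLOCK-LEVEL symbols
* `blockSum_plane`:      `blockSum N (c·pw) y = c · pw(N•y) · Π_i gsum k_i N`            (the M-row / box factor `S`);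
* `contourSum_plane`:    `contourSum N (v·pw) κ y = v_κ · pw(N•y) · (Π_i gsum k_i N) · gsum k_κ N`   (the Q-row weights `S·s_κ`).
These are the per-fine-momentum blocks `T(k)` and border weights of `SKELETON-P1.md` S1a (executable specification `diag/kkt_fourier.py`, validated against the direct transcription
of `resid`); the block-level rows/columns (contour sums, their adjoint, block sums, the block-constant gauge freedom) are NOT treated here.
-/

noncomputable section

open Complex Finset
open scoped BigOperators
open Literature.MathematicalPhysics.QuantumFieldTheory.Balaban1983to89.Beta
open AffineAveraging (Site Form0 Form1 Form2 unitVec unitVec_apply dz curv curvAdj codiff₁)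

namespace Summit.QuantumFields.BalabanUV.Beta.GAN24.FibreSymbols

variable {D : ℕ}

/-- [folklore] The fine plane wave `exp(i k·x)` at (complex) momentum `k`. -/
def pw (k : Fin D → ℂ) (x : Site D) : ℂ := cexp (I * ∑ μ, k μ * (x μ : ℂ))

/-- [folklore] Forward-difference symbol `∂̂_κ(k) = e^{ik_κ} − 1`. -/
def dhat (k : Fin D → ℂ) (κ : Fin D) : ℂ := cexp (I * k κ) - 1

/-- [folklore] Reflected symbol `∂̂♭_κ(k) = e^{−ik_κ} − 1` (the complex conjugate of `∂̂_κ` when `k` is real). -/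
def dflat (k : Fin D → ℂ) (κ : Fin D) : ℂ := cexp (-(I * k κ)) - 1

/-- [folklore] The Laplacian symbol `L(k) = Σ_κ ∂̂_κ ∂̂♭_κ` (`= |∂̂|² = Σ 4 sin²(k_κ/2)` for real `k`). -/
def lapSym (k : Fin D → ℂ) : ℂ := ∑ κ, dhat k κ * dflat k κ

/-- [folklore] A scalar plane wave with amplitude `c`. -/
def pw0 (k : Fin D → ℂ) (c : ℂ) : Form0 D ℂ := fun x => c * pw k x

/-- [folklore] A 1-form plane wave with polarisation `v`. -/
def pw1 (k : Fin D → ℂ) (v : Fin D → ℂ) : Form1 D ℂ := fun κ x => v κ * pw k x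

/-- [folklore] Shift rule `pw k (x + e_κ) = e^{ik_κ} · pw k x`. -/
theorem pw_add_unitVec (k : Fin D → ℂ) (x : Site D) (κ : Fin D) : pw k (x + unitVec κ) = cexp (I * k κ) * pw k x := by
  unfold pw
  rw [← Complex.exp_add]
  congr 1
  have h : ∑ μ, k μ * (((x + unitVec κ) μ : ℤ) : ℂ) = ∑ μ, (k μ * (x μ : ℂ) + (if μ = κ then k μ else 0)) := by
    refine Finset.sum_congr rfl fun μ _ => ?_
    simp only [Pi.add_apply, unitVec_apply, Int.cast_add]
    split_ifs with h
    · subst h; push_cast; ring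
    · push_cast; ring
  rw [h, Finset.sum_add_distrib, Finset.sum_ite_eq' Finset.univ κ, if_pos (Finset.mem_univ κ)]
  ring

/-- [folklore] Shift rule `pw k (x − e_κ) = e^{−ik_κ} · pw k x`. -/
theorem pw_sub_unitVec (k : Fin D → ℂ) (x : Site D) (κ : Fin D) : pw k (x - unitVec κ) = cexp (-(I * k κ)) * pw k x := by
  have h := pw_add_unitVec k (x - unitVec κ) κ
  rw [sub_add_cancel] at h
  rw [h, ← mul_assoc, ← Complex.exp_add, neg_add_cancel, Complex.exp_zero, one_mul]

/-- [folklore] GRADIENT: `dz (c·pw) = (∂̂_κ c) · pw`. -/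
theorem dz_plane (k : Fin D → ℂ) (c : ℂ) : dz (pw0 k c) = pw1 k (fun κ => dhat k κ * c) := by
  funext κ x
  simp only [dz, pw0, pw1, dhat, pw_add_unitVec]
  ring

/-- [folklore] CODIFFERENTIAL: `codiff₁ (v·pw) = (Σ_κ ∂̂♭_κ v_κ) · pw`. -/
theorem codiff₁_plane (k : Fin D → ℂ) (v : Fin D → ℂ) : codiff₁ (pw1 k v) = pw0 k (∑ κ, dflat k κ * v κ) := by
  funext x
  simp only [codiff₁, pw1, pw0, dflat, pw_sub_unitVec, Finset.sum_mul]
  exact Finset.sum_congr rfl fun κ _ => by ring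

/-- [folklore] CURVATURE: `curv (v·pw) κ l = (∂̂_κ v_l − ∂̂_l v_κ) · pw`. -/
theorem curv_plane (k : Fin D → ℂ) (v : Fin D → ℂ) (κ l : Fin D) (x : Site D) :
    curv (pw1 k v) κ l x = (dhat k κ * v l - dhat k l * v κ) * pw k x := by
  simp only [curv, pw1, dhat, pw_add_unitVec]
  ring

/-- [folklore] **CURL–CURL SYMBOL**: `curvAdj (curv (v·pw)) = (μ ↦ 2(L v_μ − ∂̂_μ Σ_κ ∂̂♭_κ v_κ)) · pw` — the A–A block `2(|∂̂|²·1 − ∂̂∂̂♭ᵀ)` of `T(k)`. -/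
theorem curvAdj_curv_plane (k : Fin D → ℂ) (v : Fin D → ℂ) :
    curvAdj (curv (pw1 k v)) = pw1 k (fun μ => 2 * (lapSym k * v μ - dhat k μ * ∑ κ, dflat k κ * v κ)) := by
  funext μ y
  have hc : ∀ κ l (x : Site D), curv (pw1 k v) κ l x = (dhat k κ * v l - dhat k l * v κ) * pw k x := curv_plane k v
  simp only [curvAdj, hc, pw_sub_unitVec, pw1, lapSym]
  -- both sides are finite sums; normalise
  have e1 : ∀ l, (dhat k μ * v l - dhat k l * v μ) * pw k y - (dhat k μ * v l - dhat k l * v μ) * (cexp (-(I * k l)) * pw k y)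
      = -(dflat k l) * (dhat k μ * v l - dhat k l * v μ) * pw k y := by
    intro l; simp only [dflat]; ring
  have e2 : ∀ κ, (dhat k κ * v μ - dhat k μ * v κ) * (cexp (-(I * k κ)) * pw k y) - (dhat k κ * v μ - dhat k μ * v κ) * pw k y
      = dflat k κ * (dhat k κ * v μ - dhat k μ * v κ) * pw k y := by
    intro κ; simp only [dflat]; ring
  simp only [e1, e2]
  rw [← Finset.sum_add_distrib]
  have e3 : ∀ κ, -dflat k κ * (dhat k μ * v κ - dhat k κ * v μ) * pw k y + dflat k κ * (dhat k κ * v μ - dhat k μ * v κ) * pw k y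
      = (2 * (dhat k κ * dflat k κ) * v μ - 2 * dhat k μ * (dflat k κ * v κ)) * pw k y := by
    intro κ; ring
  simp only [e3]
  rw [← Finset.sum_mul, Finset.sum_sub_distrib, ← Finset.sum_mul, ← Finset.mul_sum, ← Finset.mul_sum]
  ring

/-- [folklore] **GAUGE-COLUMN SYMBOL**: `dz (codiff₁ (dz (c·pw))) = (κ ↦ ∂̂_κ · L · c) · pw` — the `μ`-column `∂̂ |∂̂|²` of `T(k)`. -/
theorem gauge_plane (k : Fin D → ℂ) (c : ℂ) : dz (codiff₁ (dz (pw0 k c))) = pw1 k (fun κ => dhat k κ * lapSym k * c) := by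
  rw [dz_plane, codiff₁_plane, dz_plane]
  unfold pw1 lapSym
  funext κ x
  show (dhat k κ * ∑ l, dflat k l * (dhat k l * c)) * pw k x = (dhat k κ * (∑ l, dhat k l * dflat k l) * c) * pw k x
  congr 1
  rw [Finset.mul_sum, Finset.mul_sum, Finset.sum_mul]
  exact Finset.sum_congr rfl fun l _ => by ring

/-- [folklore] **G-ROW SYMBOL**: `codiff₁ (dz (codiff₁ (v·pw))) = (L · Σ_κ ∂̂♭_κ v_κ) · pw` — the gauge row `|∂̂|² ∂̂♭ᵀ` of `T(k)`. -/
theorem Gamma_plane (k : Fin D → ℂ) (v : Fin D → ℂ) :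
    codiff₁ (dz (codiff₁ (pw1 k v))) = pw0 k (lapSym k * ∑ κ, dflat k κ * v κ) := by
  rw [codiff₁_plane, dz_plane, codiff₁_plane]
  unfold pw0 lapSym
  funext x
  show (∑ κ, dflat k κ * (dhat k κ * ∑ l, dflat k l * v l)) * pw k x = ((∑ κ, dhat k κ * dflat k κ) * ∑ l, dflat k l * v l) * pw k x
  congr 1
  rw [Finset.sum_mul]
  exact Finset.sum_congr rfl fun l _ => by ring

/-! ## §2 (v1.1, APPEND-ONLY) Block-level symbols: block sums and straight-contour sums of plane waves (the Q-row / M-row weights `S`, `s_κ`) -/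

/-- [folklore] The one-dimensional geometric-sum factor `Σ_{t<N} e^{i z t}` (for `z = k_κ`: the contour factor `s_κ`; the product over directions is the box factor `S`). -/
def gsum (z : ℂ) (N : ℕ) : ℂ := ∑ t ∈ Finset.range N, cexp (I * z * (t : ℂ))

/-- [folklore] Additivity of the plane wave: `pw k (x + y) = pw k x · pw k y`. -/
theorem pw_add (k : Fin D → ℂ) (x y : Site D) : pw k (x + y) = pw k x * pw k y := by
  unfold pw
  rw [← Complex.exp_add, ← mul_add, ← Finset.sum_add_distrib]
  congr 2
  exact Finset.sum_congr rfl fun μ _ => by simp only [Pi.add_apply, Int.cast_add]; ring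

/-- [folklore] The plane wave along a straight contour step: `pw k (t • e_κ) = e^{i k_κ t}`. -/
theorem pw_natSmul_unitVec (k : Fin D → ℂ) (κ : Fin D) (t : ℕ) : pw k ((t : ℤ) • unitVec κ) = cexp (I * k κ * (t : ℂ)) := by
  unfold pw
  congr 1
  have h : ∑ μ, k μ * ((((t : ℤ) • unitVec κ) μ : ℤ) : ℂ) = ∑ μ, (if μ = κ then k μ * (t : ℂ) else 0) := by
    refine Finset.sum_congr rfl fun μ _ => ?_
    simp only [Pi.smul_apply, unitVec_apply, smul_eq_mul]
    split_ifs with h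
    · subst h; push_cast; ring
    · simp
  rw [h, Finset.sum_ite_eq' Finset.univ κ, if_pos (Finset.mem_univ κ)]
  ring

/-- [folklore] The plane wave at a box offset factorises over the coordinates: `pw k (toSite b) = Π_i e^{i k_i b_i}`. -/
theorem pw_toSite (k : Fin D → ℂ) (b : Fin D → ℕ) : pw k (AffineAveraging.toSite b) = ∏ i, cexp (I * k i * (b i : ℂ)) := by
  unfold pw AffineAveraging.toSite
  rw [Finset.mul_sum, Complex.exp_sum]
  refine Finset.prod_congr rfl fun i _ => ?_
  push_cast; ring_nf

/-- [folklore] **BLOCK-SUM SYMBOL** (the M row / the factor `S`): `blockSum N (c·pw) y = c · pw k (N•y) · Π_i gsum (k_i) N`. -/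
theorem blockSum_plane (k : Fin D → ℂ) (c : ℂ) (N : ℕ) (y : Site D) :
    AffineAveraging.blockSum N (pw0 k c) y = c * pw k ((N : ℤ) • y) * ∏ i, gsum (k i) N := by
  unfold AffineAveraging.blockSum pw0 gsum
  simp only [pw_add, pw_toSite]
  rw [← Finset.sum_prod_piFinset]
  unfold AffineAveraging.box
  rw [Finset.mul_sum]
  exact Finset.sum_congr rfl fun b _ => by ring

/-- [folklore] **CONTOUR-SUM SYMBOL** (the Q rows / the factor `S · s_κ`): `contourSum N (v·pw) κ y = v_κ · pw k (N•y) · (Π_i gsum (k_i) N) · gsum (k_κ) N`. -/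
theorem contourSum_plane (k : Fin D → ℂ) (v : Fin D → ℂ) (N : ℕ) (κ : Fin D) (y : Site D) :
    AffineAveraging.contourSum N (pw1 k v) κ y = v κ * pw k ((N : ℤ) • y) * (∏ i, gsum (k i) N) * gsum (k κ) N := by
  unfold AffineAveraging.contourSum pw1
  simp only [pw_add, pw_toSite, pw_natSmul_unitVec]
  have h1 : ∀ b ∈ AffineAveraging.box D N, ∑ s ∈ Finset.range N, v κ * (pw k ((N : ℤ) • y) * (∏ i, cexp (I * k i * ((b i : ℕ) : ℂ))) * cexp (I * k κ * (s : ℂ)))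
      = v κ * pw k ((N : ℤ) • y) * (∏ i, cexp (I * k i * ((b i : ℕ) : ℂ))) * gsum (k κ) N := by
    intro b _
    unfold gsum
    rw [Finset.mul_sum]
    exact Finset.sum_congr rfl fun s _ => by ring
  rw [Finset.sum_congr rfl h1]
  have h2 : ∑ b ∈ AffineAveraging.box D N, v κ * pw k ((N : ℤ) • y) * (∏ i, cexp (I * k i * ((b i : ℕ) : ℂ))) * gsum (k κ) N
      = v κ * pw k ((N : ℤ) • y) * (∑ b ∈ AffineAveraging.box D N, ∏ i, cexp (I * k i * ((b i : ℕ) : ℂ))) * gsum (k κ) N := by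
    rw [Finset.mul_sum, Finset.sum_mul]
  rw [h2]
  unfold AffineAveraging.box gsum
  congr 2
  exact Finset.sum_prod_piFinset (Finset.range N) (fun i (t : ℕ) => cexp (I * k i * (t : ℂ)))

end Summit.QuantumFields.BalabanUV.Beta.GAN24.FibreSymbols

end
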